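import Summits.QuantumFields.YangMills.Theorems.UnitScaleTiltFluctuationComparisonRegPrAnsatzTStub

/-!
# Route `UnitScaleTilt` — crux `FluctuationComparisonRegPr` (stmt-QuantumFields-19201, aside; registered skeleton
# `Cruxes/FluctuationComparisonRegPr/Lines/birth_v5d.lean`, sha16 4707e8c063aa0596): **STUB 1 `stub_oneStepSmallLift` BY NAME**.

The registered STUB 1 of birth_v5d (text byte-identical with STUB 1 of the sibling skeletons on stmt-QuantumFields-19935 and
stmt-QuantumFields-20520) is CLOSED in the tree by
`Summit.QuantumFields.YangMills.Theorems.ApproxLift.AnsatzT.stub_oneStepSmallLift` (p490827, filed under stmt-QuantumFields-19935;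
the by-name credit on stmt-QuantumFields-20520 is `IntLStub1.stub_oneStepSmallLift`).  This file records the same by-name credit against
stmt-QuantumFields-19201, whose registry still lists `stub_oneStepSmallLift` as open.  Nothing new is proved here: `L = 3` by the certified
face-supported table (`CertL3Tree.certL3_clause`, `native_decide` certificate facts — computational in the same sense as p490827), every odd
`L ≥ 5` by ANSATZ S / ANSATZ T with the Γ-leg interior assembly, every other `L` carries no `T3Family`.

Cell `ym3-torus` (HUMAN RULING D-0037: YM₃ on T³ is ladder rung R3, not the Clay problem), seat `leafhand-qf-unitscaletilt-2` gen 0.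
Honest label: closes one registered stub of an ASIDE item by name; no crux, no rung, no summit is proved by this file.
-/

noncomputable section

namespace Summit.QuantumFields.YangMills.Theorems.Stub1Of19201

open Literature.MathematicalPhysics.QuantumFieldTheory.Balaban1983to89
open Literature.MathematicalPhysics.QuantumFieldTheory.Balaban1983to89.T3ContinuumYM3Torus
open Literature.MathematicalPhysics.QuantumFieldTheory.Balaban1983to89.T3UnitLawDensityEML (ℰp)
open Literature.MathematicalPhysics.QuantumFieldTheory.Balaban1983to89.T3SmallLiftHistory (OneStepSmallLift)

/-- **STUB 1 of birth_v5d, `stub_oneStepSmallLift`, BY NAME** (registered text verbatim): for every block size `L` there are a gain `κ`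
with `κ√L ≤ 1` and a threshold `δ₀ > 0` such that every `T3Family` of block size `L` has the one-step small lift `OneStepSmallLift F ℰp κ δ₀`.
Proof: `ApproxLift.AnsatzT.stub_oneStepSmallLift` (p490827). [cite: Balaban1987RG1, (0.4) p.253 and (0.16) p.255] -/
theorem stub_oneStepSmallLift :
    ∀ L : ℕ, ∃ κ δ₀ : ℝ, κ * Real.sqrt L ≤ 1 ∧ 0 < δ₀ ∧
      ∀ F : T3Family, F.L = L → OneStepSmallLift F ℰp κ δ₀ :=
  ApproxLift.AnsatzT.stub_oneStepSmallLift

end Summit.QuantumFields.YangMills.Theorems.Stub1Of19201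

end
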